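/-
Copyright (c) 2026 the pub-hodgecm-mathlib formalisation cell (harness21).  Prover seat hodgecm-mathlib-LH4-p04 (g8), req620 Track A «(D-RAM) FOUR-FRAME» squad
(STAGE-1b, row (2) of the piece `f_{T₊}`, the (β₂) road; dealer∕pen LH4-plan (g13) WORD #108 (4) ∕ WORD #112 (1): «(S4) β₂ ASSEMBLY», LH4-p04 lineage; brick (S4-disc)), 2026-09-04.
-/
import Literature.NumberTheory.Automorphic.EllipticPlaneAsFieldLineHermitian   -- ★ p857425: `pairing_single_single`; brings ★ `pairing`
import Literature.NumberTheory.Automorphic.UnitaryGroupFrameSubform          -- ★ `det_formCongr`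
import Literature.NumberTheory.Automorphic.UnitaryLatticeTreeAxisEndoFrame   -- ★ (z1-b): `det_endoShape`
import HarnessLib

/-!
# Crux `H413`, line LH4 «(D-RAM) FOUR-FRAME» — STAGE-1b, row (2), the (β₂) road, brick (S4-disc): «THE FORM CONSTANTS OF THE TWO LITERALS DIFFER BY THE NON-NORM CLASS»
# in the line model, `jE(det H₂) = N_ρ(h)·N_Θ(D)`; hence for the two literals of `beta2Models.letter.v1`: `N_ρ(h′)·jE η = N_ρ(h)·jE(N_{E/F} s)` for some `s ≠ 0`

Cell `hodgecm-mathlib` (D-0151), FLOOR 0, crux item H413 = `stmt-HodgeConjecture-24833`, route of record `HCCMUnconditional`; squad F0∕P3c∕LH4; lane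
`--supports stmt-HodgeConjecture-24833 --as helper` (count-neutral; pays NO tier-0 row).  THEOREMS ONLY (no `def`, no instance, no notation, no `sorry`, default heartbeats).
DATUM-FREE: abstract fields `E` (the plane's scalars) and `M` (the line model), ring maps `σ`, `jE`, `ρ`, `Θ`; no valuation, no residue field, no `|2|`.

WHY.  In the producers' socket of the (β₂) road (`beta2Models.letter.v1` 46d52237, ★-cand `…CleanSgnDiffTypeTwoOfModels`) the two literal planes `((Φ₂)_w, g_w)` and `(diag dg, γ₁)`
come with INDEPENDENT line models `(φ, h)` and `(φ′, h′)` over the SAME eigen-field `M = E′_{w₁}` with the SAME `lam` (`hform`, `hform′`), and with the frame clause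
`formCongr σ_w P₁ (Φ₃)_w = block(diag dg, η)`, `η` a NON-NORM unit.  LH4-p13 (g8)'s (S-2) chain (★ p861023 part ii: plane value `⟨β′, (γ₂ − 1)β′⟩`; ★ p861134 part iii: on the line the
thickened value set sees the constant `c` only modulo `{Θ(w)·w}`) therefore needs ONE dictionary fact relating `h′` to `h` (14:57:44Z).  THIS FILE supplies it, in CLASS FORM:
* §1 `map_det_eq_norm_mul_norm_of_lineModel` — for ANY line model `(φ, h)` of `(E², H₂)` into `(M, jE, ρ, Θ)` (`Θ` commuting with `ρ`; neither `Θ² = 1` nor `Θ h = h` is needed):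
  **`jE (det H₂) = (h·ρ h)·(D·Θ D)`**, `D := φ(e₀)·ρ(φ(e₁)) − φ(e₁)·ρ(φ(e₀))` (the matrix entries are `⟨eᵢ, eⱼ⟩` ★ `pairing_single_single`; then a polynomial identity in the eight atoms
  `φeᵢ, ρφeᵢ, Θφeᵢ, ρΘφeᵢ` and `h, ρh`).
* §2 `exists_discr_eq_map_mul_of_lineModels` — two `jE`-semilinear models `φ` (onto) and `φ′` into the same `M` (`ρ ∘ jE = jE`): `D′ = jE(t)·D` with
  `t = x₀(0)·x₁(1) − x₀(1)·x₁(0)` for any `xⱼ` with `φ xⱼ = φ′ eⱼ` (the determinant of the `E`-linear change of model).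
* §3 `map_det_mul_norm_eq_of_lineModels` — eliminating `D`: **`jE(det H₂′)·(h·ρh) = (h′·ρh′)·jE(t·σt)·jE(det H₂)`** (`Θ ∘ jE = jE ∘ σ`).
* §4 HEAD `exists_norm_h_mul_eq_of_block_frame` — with the frame clause in determinant form `det H₂′ · η = (σ p · p)·det H₂` (what `formCongr σ P₁ (block(H₂, 1)) = block(H₂′, η)` gives by
  ★ `det_formCongr` + ★ `det_endoShape`, `p = det P₁`; lemma `det_mul_eq_of_formCongr_block`), `det H₂ ≠ 0`, `h ≠ 0`, `ρ h ≠ 0`: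
  **`∃ s : E, s ≠ 0 ∧ h′·ρh′·jE η = h·ρh·jE(s·σs)`** — `N_ρ(h′)·η ≡ N_ρ(h) (mod N_{E∕F}(E^×))`: the two form constants differ by the NON-NORM class (so `h′ ∉ h·Θ(w)w·F^×` exactly —
  `N_ρ(Θ(w)w) = N_{M∕F}(w) ∈ N(E^×)`, `N_ρ(e) = e²` — and (S-2)'s «`h′ ∈ h·Θ(w)·w·(1 + 𝔭^{k})`» can hold only for `k` below the conductor of `N_{E∕F}`: the GENERIC range).
HONEST LABEL.  Count-neutral field algebra; nothing printed is asserted; no census law is stated; (β₂) and its letters stay HYPOTHESES; `HC_CM` is proved only modulo the 7 printed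
citations (2 remaining named inputs: hLiu418 = `stmt-HodgeConjecture-24832`, h413 = `stmt-HodgeConjecture-24833`) until rung 0 closes.
## References
* [Jacobowitz1962] R. Jacobowitz, *Hermitian forms over local fields*, Amer. J. Math. 84 (1962): §4 (hermitian lines `Tr(h·x̄y)`; the determinant ∕ norm-class invariant).
* [Rogawski1990] J. D. Rogawski, *Automorphic Representations of Unitary Groups in Three Variables*, Ann. of Math. Stud. 123 (1990): §4.9 Lemma 4.9.3 p. 56; §3.5 Prop. 3.5.2 (c).
* [Dieudonne1971GroupesClassiques] J. Dieudonné, *La géométrie des groupes classiques*, 3e éd. (1971): Chap. II §5 (determinant of a frame equation).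
-/

set_option autoImplicit false

noncomputable section

namespace Summit.HodgeConjecture.HodgeConjecture.Cruxes.H413.F0P3cDyRamLineModelFormConstantClass

open scoped Matrix MatrixGroups
open Literature.NumberTheory.Automorphic Literature.NumberTheory.Automorphic.UnitaryLatticeTree
open Literature.NumberTheory.Automorphic.EllipticPlaneAsFieldLine
open Literature.NumberTheory.Automorphic.UnitaryGroup (det_formCongr)

variable {E M : Type*} [Field E] [Field M]

/-! ## §1 The determinant of the plane in the line model -/

/-- **`jE(det H₂) = N_ρ(h)·N_Θ(D)` IN THE LINE MODEL.**  For `φ : E² → M` with `jE⟨x, y⟩_{H₂} = h·Θ(φx)·φy + ρ(h·Θ(φx)·φy)` and `Θ` commuting with `ρ`: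
`jE (det H₂) = (h·ρ h)·(D·Θ D)`, `D = φ(e₀)·ρ(φ(e₁)) − φ(e₁)·ρ(φ(e₀))`. [cite: Jacobowitz1962, §4] [cite: Rogawski1990, §4.9 Lemma 4.9.3 p. 56] -/
theorem map_det_eq_norm_mul_norm_of_lineModel (σ : E →+* E) (H₂ : Matrix (Fin 2) (Fin 2) E) (jE : E →+* M) (ρ Θ : M →+* M)
    (hΘρ : ∀ x, Θ (ρ x) = ρ (Θ x)) (φ : (Fin 2 → E) →+ M) {h : M}
    (hform : ∀ x y, jE (pairing σ H₂ x y) = h * Θ (φ x) * φ y + ρ (h * Θ (φ x) * φ y)) :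
    jE H₂.det = (h * ρ h) *
      ((φ (Pi.single 0 1) * ρ (φ (Pi.single 1 1)) - φ (Pi.single 1 1) * ρ (φ (Pi.single 0 1))) *
        Θ (φ (Pi.single 0 1) * ρ (φ (Pi.single 1 1)) - φ (Pi.single 1 1) * ρ (φ (Pi.single 0 1)))) := by
  have hent : ∀ i j : Fin 2, jE (H₂ i j) = h * Θ (φ (Pi.single i 1)) * φ (Pi.single j 1) + ρ (h * Θ (φ (Pi.single i 1)) * φ (Pi.single j 1)) := fun i j => by
    rw [← EllipticPlaneAsFieldLine.pairing_single_single σ H₂ i j, hform]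
  have hρΘ : ∀ x, ρ (Θ x) = Θ (ρ x) := fun x => (hΘρ x).symm
  rw [Matrix.det_fin_two, map_sub, map_mul, map_mul, hent, hent, hent, hent]
  simp only [map_mul, map_sub, hρΘ]
  ring

/-! ## §2 Two line models into the same eigen-field: the change of model and its determinant -/

/-- **CHANGE OF LINE MODEL.**  For a `jE`-semilinear ONTO model `φ` and a `jE`-semilinear model `φ′` into the same `(M, jE, ρ)` (`ρ ∘ jE = jE`): with `φ xⱼ = φ′ eⱼ` (`j = 0, 1`),
`D′ = jE(t)·D`, `t = x₀(0)·x₁(1) − x₀(1)·x₁(0)`, where `D, D′` are the §1 discriminant elements of `φ, φ′`. [cite: Jacobowitz1962, §4] -/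
theorem exists_discr_eq_map_mul_of_lineModels (jE : E →+* M) (ρ : M →+* M) (hρj : ∀ c, ρ (jE c) = jE c)
    (φ φ' : (Fin 2 → E) →+ M) (hφs : ∀ (c : E) (x : Fin 2 → E), φ (c • x) = jE c * φ x) (hφo : Function.Surjective φ) :
    ∃ t : E,
      φ' (Pi.single 0 1) * ρ (φ' (Pi.single 1 1)) - φ' (Pi.single 1 1) * ρ (φ' (Pi.single 0 1)) =
        jE t * (φ (Pi.single 0 1) * ρ (φ (Pi.single 1 1)) - φ (Pi.single 1 1) * ρ (φ (Pi.single 0 1))) := by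
  obtain ⟨x₀, hx₀⟩ := hφo (φ' (Pi.single 0 1))
  obtain ⟨x₁, hx₁⟩ := hφo (φ' (Pi.single 1 1))
  -- coordinates: `φ x = jE (x 0)·φ e₀ + jE (x 1)·φ e₁`
  have hcoord : ∀ x : Fin 2 → E, φ x = jE (x 0) * φ (Pi.single 0 1) + jE (x 1) * φ (Pi.single 1 1) := fun x => by
    have e : x = x 0 • (Pi.single 0 1 : Fin 2 → E) + x 1 • (Pi.single 1 1 : Fin 2 → E) := by
      ext i; fin_cases i <;> simp
    conv_lhs => rw [e]
    rw [map_add, hφs, hφs]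
  refine ⟨x₀ 0 * x₁ 1 - x₀ 1 * x₁ 0, ?_⟩
  rw [← hx₀, ← hx₁, hcoord x₀, hcoord x₁]
  simp only [map_add, map_mul, map_sub, hρj]
  ring

/-! ## §3 The two determinants compared, `D` eliminated -/

/-- **`jE(det H₂′)·N_ρ(h) = N_ρ(h′)·jE(t·σt)·jE(det H₂)`** for two line models of `(E², H₂)`, `(E², H₂′)` into the same `(M, jE, ρ, Θ)` (`φ` onto; `Θ ∘ jE = jE ∘ σ`, `ρ ∘ jE = jE`).
[cite: Jacobowitz1962, §4] [cite: Rogawski1990, §4.9 Lemma 4.9.3 p. 56] -/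
theorem exists_map_det_mul_norm_eq_of_lineModels (σ : E →+* E) (H₂ H₂' : Matrix (Fin 2) (Fin 2) E) (jE : E →+* M) (ρ Θ : M →+* M)
    (hρj : ∀ c, ρ (jE c) = jE c) (hΘj : ∀ c, Θ (jE c) = jE (σ c)) (hΘρ : ∀ x, Θ (ρ x) = ρ (Θ x))
    (φ φ' : (Fin 2 → E) →+ M) (hφs : ∀ (c : E) (x : Fin 2 → E), φ (c • x) = jE c * φ x) (hφo : Function.Surjective φ)
    {h h' : M}
    (hform : ∀ x y, jE (pairing σ H₂ x y) = h * Θ (φ x) * φ y + ρ (h * Θ (φ x) * φ y))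
    (hform' : ∀ x y, jE (pairing σ H₂' x y) = h' * Θ (φ' x) * φ' y + ρ (h' * Θ (φ' x) * φ' y)) :
    ∃ t : E, jE H₂'.det * (h * ρ h) = (h' * ρ h') * jE (t * σ t) * jE H₂.det := by
  obtain ⟨t, ht⟩ := exists_discr_eq_map_mul_of_lineModels jE ρ hρj φ φ' hφs hφo
  refine ⟨t, ?_⟩
  rw [map_det_eq_norm_mul_norm_of_lineModel σ H₂' jE ρ Θ hΘρ φ' hform', map_det_eq_norm_mul_norm_of_lineModel σ H₂ jE ρ Θ hΘρ φ hform, ht,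
    map_mul, map_mul, hΘj]
  ring

/-! ## §4 HEAD — the frame clause in determinant form, and the class relation of the two form constants -/

/-- **THE FRAME CLAUSE IN DETERMINANT FORM**: `formCongr σ P (block(H₂, 1)) = block(H₂′, η′)` gives `det H₂′ · η′ = (σ(det P)·det P)·det H₂` (★ `det_formCongr`, ★ `det_endoShape`).
[cite: Dieudonne1971GroupesClassiques, Chap. II §5] [cite: Jacobowitz1962, §4] -/
theorem det_mul_eq_of_formCongr_block (σ : E →+* E) (H₂ H₂' : Matrix (Fin 2) (Fin 2) E) (η' : E) (P : GL (Fin 3) E)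
    (hP : formCongr σ P (!![H₂ 0 0, 0, H₂ 0 1; 0, (1 : E), 0; H₂ 1 0, 0, H₂ 1 1] : Matrix (Fin 3) (Fin 3) E) =
      (!![H₂' 0 0, 0, H₂' 0 1; 0, η', 0; H₂' 1 0, 0, H₂' 1 1] : Matrix (Fin 3) (Fin 3) E)) :
    H₂'.det * η' = (σ (P : Matrix (Fin 3) (Fin 3) E).det * (P : Matrix (Fin 3) (Fin 3) E).det) * H₂.det := by
  have h := congrArg Matrix.det hP
  rw [det_formCongr, det_endoShape, det_endoShape, mul_one] at h
  rw [← h]; ring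

/-- **(S4-disc) THE FORM CONSTANTS OF THE TWO LITERALS DIFFER BY THE NON-NORM CLASS.**  Two line models `(φ, h)` of `(E², H₂)` and `(φ′, h′)` of `(E², H₂′)` into the same
`(M, jE, ρ, Θ)` (`φ` onto; `Θ` commuting with `ρ` and extending `σ`; `ρ ∘ jE = jE`), the frame clause in determinant form
`det H₂′ · η′ = (σ p · p)·det H₂`, and `det H₂ ≠ 0`, `h·ρ h ≠ 0`, `η′ ≠ 0`.  Then **`∃ s ≠ 0, h′·ρ h′·jE η′ = h·ρ h·jE (s·σ s)`** — `N_ρ(h′)·η′ ≡ N_ρ(h)` modulo `N_{E∕F}(E^×)`.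
At `beta2Models.letter.v1`: `H₂ = (Φ₂)_w`, `H₂′ = diag dg`, `η′ = η` NON-NORM, `p = det P₁`, `jE = toPlace w.1 w₁`, `ρ = σ_{w₁}` — the dictionary fact (S-2) asked for, in class form.
[cite: Jacobowitz1962, §4] [cite: Rogawski1990, §4.9 Lemma 4.9.3 p. 56; §3.5 Prop. 3.5.2 (c)] -/
theorem exists_norm_h_mul_eq_of_block_frame (σ : E →+* E) (H₂ H₂' : Matrix (Fin 2) (Fin 2) E) (jE : E →+* M) (ρ Θ : M →+* M)
    (hρj : ∀ c, ρ (jE c) = jE c) (hΘj : ∀ c, Θ (jE c) = jE (σ c)) (hΘρ : ∀ x, Θ (ρ x) = ρ (Θ x))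
    (φ φ' : (Fin 2 → E) →+ M) (hφs : ∀ (c : E) (x : Fin 2 → E), φ (c • x) = jE c * φ x) (hφo : Function.Surjective φ)
    {h h' : M} (hh : h * ρ h ≠ 0)
    (hform : ∀ x y, jE (pairing σ H₂ x y) = h * Θ (φ x) * φ y + ρ (h * Θ (φ x) * φ y))
    (hform' : ∀ x y, jE (pairing σ H₂' x y) = h' * Θ (φ' x) * φ' y + ρ (h' * Θ (φ' x) * φ' y))
    (hdet : H₂.det ≠ 0) {η' p : E} (hp : p ≠ 0) (hframe : H₂'.det * η' = (σ p * p) * H₂.det) :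
    ∃ s : E, s ≠ 0 ∧ h' * ρ h' * jE η' = h * ρ h * jE (s * σ s) := by
  obtain ⟨t, ht⟩ := exists_map_det_mul_norm_eq_of_lineModels σ H₂ H₂' jE ρ Θ hρj hΘj hΘρ φ φ' hφs hφo hform hform'
  have hjdet : jE H₂.det ≠ 0 := (map_ne_zero jE).2 hdet
  have hσp : σ p ≠ 0 := (map_ne_zero σ).2 hp
  have hpp : jE (p * σ p) ≠ 0 := (map_ne_zero jE).2 (mul_ne_zero hp hσp)
  -- the frame clause through `jE`, and `D` eliminated: `N_ρ(h′)·jE η′·jE(tσt) = N_ρ(h)·jE(pσp)`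
  have e2 : jE H₂'.det * jE η' = jE (σ p * p) * jE H₂.det := by rw [← map_mul, hframe, map_mul]
  have key : h' * ρ h' * jE η' * jE (t * σ t) = h * ρ h * jE (p * σ p) := by
    have e3 : (h' * ρ h' * jE η' * jE (t * σ t)) * jE H₂.det = (h * ρ h * jE (p * σ p)) * jE H₂.det := by
      calc (h' * ρ h' * jE η' * jE (t * σ t)) * jE H₂.det = ((h' * ρ h') * jE (t * σ t) * jE H₂.det) * jE η' := by ring
        _ = (jE H₂'.det * (h * ρ h)) * jE η' := by rw [ht]
        _ = (jE H₂'.det * jE η') * (h * ρ h) := by ring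
        _ = jE (σ p * p) * jE H₂.det * (h * ρ h) := by rw [e2]
        _ = (h * ρ h * jE (p * σ p)) * jE H₂.det := by rw [mul_comm (σ p) p]; ring
    exact mul_right_cancel₀ hjdet e3
  -- `t ≠ 0`
  have htt : jE (t * σ t) ≠ 0 := by
    intro h0
    rw [h0, mul_zero] at key
    exact mul_ne_zero hh hpp key.symm
  have ht0 : t ≠ 0 := by
    intro h0
    apply htt
    rw [h0, zero_mul, map_zero]
  have hσt : σ t ≠ 0 := (map_ne_zero σ).2 ht0
  refine ⟨p / t, div_ne_zero hp ht0, ?_⟩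
  -- `jE((p∕t)·σ(p∕t))·jE(tσt) = jE(pσp)`
  have e4 : jE (p / t * σ (p / t)) * jE (t * σ t) = jE (p * σ p) := by
    rw [← map_mul, map_div₀]
    congr 1
    field_simp
  apply mul_right_cancel₀ htt
  rw [key, mul_assoc (h * ρ h), e4]

end Summit.HodgeConjecture.HodgeConjecture.Cruxes.H413.F0P3cDyRamLineModelFormConstantClass

end
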